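import Literature.AlgebraicGeometry.Motives.AbelianVarietyTranslationAction
import Literature.AlgebraicGeometry.Motives.AbelianVarietyTranslationFree
import Literature.AlgebraicGeometry.Motives.AbelianVarietyProjectiveChart
import Literature.AlgebraicGeometry.Motives.FiniteQuotientRecognition
import Literature.AlgebraicGeometry.Motives.FiniteQuotientProductDescent
import Literature.AlgebraicGeometry.RelativeSpec.GeometricQuotientRecognition
import Literature.AlgebraicGeometry.RelativeSpec.EquivariantModuleRankDescent
import Literature.AlgebraicGeometry.Modules.EquivariantStructure
import HarnessLib

/-!
# `1 × φ_Θ : A × A → A × Â` is a free affine geometric quotient of `A × A` by `K(Θ)`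

Layer `Literature/AlgebraicGeometry/Motives`, namespace
`Literature.AlgebraicGeometry.Motives.AbelianVariety`. THEOREMS ONLY (the action data
`kThetaAut`, `kThetaActionOver` are in `Motives/AbelianVarietyTranslationAction`).

Let `A` be a complex abelian variety and `Θ` an ample Cartier divisor on `A`, with the tree's dual
`Â = A.dualOf Θ hΘ := A/K(Θ)`, the isogeny `φ_Θ = A.phiTheta Θ hΘ : A → Â` (`Ker φ_Θ(ℂ) = K(Θ)`,
`Motives/AbelianVarietyDualQuotient`) and `1 × φ_Θ = A.oneProdPhiTheta hΘ : A × A → A × Â`.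
Milne, *Abelian Varieties* I §8 (p. 40): "The action of `K(L)` on the second factor of `A × A`
lifts to an action on `L^*` over `A × A`, which corresponds by (8.13) to a sheaf `𝒫` on `A × A^∨`
such that `(1 × λ_L)^*𝒫 = L^*`" — i.e. the Poincaré sheaf is obtained by DESCENT along the free
quotient `1 × φ_Θ` (Mumford, *Abelian Varieties* §7 Thm. 4, §12 Thm. 1). This file proves that
`1 × φ_Θ` IS such a quotient, in the currency of the tree's descent theorems
(`RelativeSpec/EquivariantModuleDescent` (T1), `…RankDescent` (β), `…DescentUnique` (T2)):

* §1 on complex points `(1 × φ_Θ)(ℂ)` is onto (`surjective_map_oneProdPhiTheta`) with fibres the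
  `K(Θ)`-orbits (`exists_kThetaAut_of_map_eq`, from `Ker φ_Θ(ℂ) = K(Θ)`);
* §2 **`isSepQuotient_kThetaAut_oneProdPhiTheta`** — `1 × φ_Θ` is the quotient of `A × A` by
  `K(Θ)` for separated test objects (the tree's recognition theorem
  `FiniteQuotientRecognition.isSepQuotient_of_isProper_of_bijective`: `1 × φ_Θ` is proper, `A × Â`
  smooth integral, `A × A` projective — `AbelianVariety.isProjectiveOver_holds`), hence
  (`FiniteQuotientProductDescent.isGeometricQuotient_left_of_isSepQuotient`) a GEOMETRIC QUOTIENT in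
  Mumford's sense §7 Thm. p. 66: **`isGeometricQuotient_kThetaActionOver`**, together with the
  Chase–Harrison–Rosenberg FREENESS **`kThetaActionOver_free`** on every affine chart
  `(1 × φ_Θ)⁻¹V` (a non-trivial translation of `A × A` has no fixed point, the tree's
  `span_range_translation_appLE_sub_eq_top`);
* §2b the same for **`φ_Θ : A → Â` itself** (`isSepQuotient_kThetaBaseAut_phiTheta`,
  **`isGeometricQuotient_kThetaBaseActionOver`**, **`kThetaBaseActionOver_free`**) — the quotient
  data along the slices `{a} × A → {a} × Â`, e.g. for the rigidification of the Poincaré sheaf by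
  (T2) `descent_unique_of_free`;
* §3 **`exists_descent_along_oneProdPhiTheta`** / **`exists_descent_of_equivariantStructure`** — the
  data fed to (T1)+(β) `ActionOver.exists_descent_of_free_of_hasRank`: every rank-`r`
  `𝒪_{A × A}`-module with a `K(Θ)`-equivariant structure (explicit `φ` with unit/cocycle, or the
  tree's `ActionOver.EquivariantStructure`) is `(1 × φ_Θ)^* F` for a quasi-coherent `F` of rank `r`
  on `A × Â`, compatibly (for `Λ(𝒪(Θ))`, `r = 1`: the Poincaré sheaf).

Everything is proved; no definitions, no named fact, no instance, no `sorry`. Characteristic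
`0` / `ℂ` as in `Motives/AbelianVarietyDualQuotient`.

## References

* [MilneAV2008] J. S. Milne, *Abelian Varieties* (v2.00, 2008), I §8 p. 40 (`A^∨ := A/K(L)`, the
  action of `K(L)` on `L^*`, `(1 × λ_L)^*𝒫 = L^*`), Prop. 8.13, Prop. 8.14.
* [MumfordAV1970] D. Mumford, *Abelian Varieties* (1970), §7 Thm. p. 66 and Thm. 4 (p. 72), §8,
  §12 Thm. 1 (p. 112).
-/

noncomputable section

universe u

open CategoryTheory CategoryTheory.Limits AlgebraicGeometry MonoidalCategory
open Literature.AlgebraicGeometry.RelativeSpec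

namespace Literature.AlgebraicGeometry.Motives

namespace AbelianVariety

open scoped MonObj Obj

variable (A : AbelianVariety ℂ) {Θ : CartierDivisor A.X.left} (hΘ : Θ.IsAmple)

/-! ### §1 Complex points of `1 × φ_Θ`: onto, fibres = `K(Θ)`-orbits -/

/-- **`(1 × φ_Θ)(ℂ)` is onto.** [cite: MilneAV2008, I §8 Prop. 8.14 (p. 39)] -/
theorem surjective_map_oneProdPhiTheta :
    Function.Surjective (AlgPoints.map (L := ℂ) (A.oneProdPhiTheta hΘ).hom.hom.hom) := by
  haveI : Surjective (A.oneProdPhiTheta hΘ).hom.hom.hom.left := (A.isIsogeny_oneProdPhiTheta hΘ).1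
  exact AlgPoints.map_surjective_of_surjective _

/-- **The fibres of `(1 × φ_Θ)(ℂ)` are the `K(Θ)`-orbits**: two complex points of `A × A` with
the same image differ by a translation `t_{(1,g)}`, `g ∈ K(Θ)` (`Ker φ_Θ(ℂ) = K(Θ)`).
[cite: MilneAV2008, I §8 (p. 40)] -/
theorem exists_kThetaAut_of_map_eq (P P' : ComplexPoints (A.prod A).X)
    (h : AlgPoints.map (A.oneProdPhiTheta hΘ).hom.hom.hom P =
      AlgPoints.map (A.oneProdPhiTheta hΘ).hom.hom.hom P') :
    ∃ g : A.KTheta Θ, AlgPoints.map (A.kThetaAut Θ g).hom P = P' := by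
  change P ≫ _ = P' ≫ _ at h
  -- first coordinates agree
  have h₁ : P ≫ (AbelianVariety.fst A A).hom.hom.hom =
      P' ≫ (AbelianVariety.fst A A).hom.hom.hom := by
    rw [← oneProdPhiTheta_comp_fst A hΘ, ← Category.assoc, h, Category.assoc]
  -- second coordinates agree after `φ_Θ`
  have h₂ : (P ≫ (AbelianVariety.snd A A).hom.hom.hom) ≫ (A.phiTheta Θ hΘ).hom.hom.hom =
      (P' ≫ (AbelianVariety.snd A A).hom.hom.hom) ≫ (A.phiTheta Θ hΘ).hom.hom.hom := by
    rw [Category.assoc, Category.assoc, ← oneProdPhiTheta_comp_snd A hΘ, ← Category.assoc, h,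
      Category.assoc]
  set b := P ≫ (AbelianVariety.snd A A).hom.hom.hom with hb
  set b' := P' ≫ (AbelianVariety.snd A A).hom.hom.hom with hb'
  have hmem : b⁻¹ * b' ∈ A.KTheta Θ := by
    rw [← A.ker_monoidHom_phiTheta hΘ, MonoidHom.mem_ker, map_mul, map_inv]
    change (b ≫ _)⁻¹ * (b' ≫ _) = 1
    rw [h₂, inv_mul_cancel]
  refine ⟨⟨b⁻¹ * b', hmem⟩, ?_⟩
  change P ≫ (A.kThetaAut Θ _).hom = P'
  rw [kThetaAut_apply, comp_secondTranslationAut_hom]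
  apply prodPoints_ext A A
  · rw [mul_comp_fst, inrPoint_comp_fst, one_mul, h₁]
  · rw [mul_comp_snd, inrPoint_comp_snd, ← hb, mul_comm, ← mul_assoc, mul_inv_cancel, one_mul]

/-! ### §2 `1 × φ_Θ` is a free affine geometric quotient of `A × A` by `K(Θ)` -/

/-- **`1 × φ_Θ` is the quotient of `A × A` by `K(Θ)` for separated test objects** (a categorical
quotient among `ℂ`-schemes separated over `ℂ`): by the tree's recognition theorem
`isSepQuotient_of_isProper_of_bijective` — `1 × φ_Θ` is proper (an isogeny), invariant, onto on
complex points with fibres the `K(Θ)`-orbits, and `A × Â` is smooth and integral.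
[cite: MumfordAV1970, §7 Thm. 4 (p. 72)] -/
theorem isSepQuotient_kThetaAut_oneProdPhiTheta :
    IsSepQuotient (fun g => A.kThetaAut Θ g) (A.oneProdPhiTheta hΘ).hom.hom.hom := by
  haveI : Finite ↥(A.KTheta Θ) := A.finite_kTheta_subtype hΘ
  haveI : IsIntegral (A.prod A).X.left :=
    GeometricallyIntegral.isIntegral_of_subsingleton (A.prod A).X.hom
  haveI : IsIntegral (A.prod (A.dualOf Θ hΘ)).X.left :=
    GeometricallyIntegral.isIntegral_of_subsingleton (A.prod (A.dualOf Θ hΘ)).X.hom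
  haveI : Smooth (A.prod (A.dualOf Θ hΘ)).X.hom := (A.prod (A.dualOf Θ hΘ)).smooth_hom
  haveI : IsProper (A.oneProdPhiTheta hΘ).hom.hom.hom.left :=
    haveI := (A.isIsogeny_oneProdPhiTheta hΘ).2; inferInstance
  exact isSepQuotient_of_isProper_of_bijective (A.kThetaAut Θ) (A.oneProdPhiTheta hΘ).hom.hom.hom
    (ActionOver.forall_exists_stableAffineOpen_of_isProjectiveOver _
      (AbelianVariety.isProjectiveOver_holds (A.prod A)))
    (A.kThetaAut_hom_comp_oneProdPhiTheta hΘ) (A.surjective_map_oneProdPhiTheta hΘ)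
    (A.exists_kThetaAut_of_map_eq hΘ)

/-- **`1 × φ_Θ` is an affine geometric quotient of `A × A` by `K(Θ)`** in Mumford's sense
(`IsGeometricQuotient`: surjective, open, fibres = orbits,
`𝒪_{A × Â} = ((1 × φ_Θ)_* 𝒪_{A × A})^{K(Θ)}`) for the action over `Spec ℂ`, and `1 × φ_Θ` is an
affine morphism (the tree's `isGeometricQuotient_left_of_isSepQuotient` for the projective
`A × A`). [cite: MumfordAV1970, §7 Thm. p. 66 and Thm. 4 (p. 72)] -/
theorem isGeometricQuotient_kThetaAut_oneProdPhiTheta :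
    (⟨((Over.forget _).mapAut (A.prod A).X).comp (A.kThetaAut Θ),
        fun g => Over.w (A.kThetaAut Θ g).hom⟩ :
        ActionOver (A.prod A).X.hom ↥(A.KTheta Θ)).IsGeometricQuotient
      (Hom.toSchemeHom (A.oneProdPhiTheta hΘ)) ∧
    IsAffineHom (Hom.toSchemeHom (A.oneProdPhiTheta hΘ)) := by
  haveI : Finite ↥(A.KTheta Θ) := A.finite_kTheta_subtype hΘ
  exact isGeometricQuotient_left_of_isSepQuotient (AbelianVariety.isProjectiveOver_holds (A.prod A))
    inferInstance (A.kThetaAut Θ) (A.oneProdPhiTheta hΘ).hom.hom.hom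
    (A.isSepQuotient_kThetaAut_oneProdPhiTheta hΘ)

/-- **`1 × φ_Θ : A × A → A × Â` is a geometric quotient by `K(Θ)`** in the currency of the
descent theorems (`ActionOver.IsGeometricQuotient` for `kThetaActionOver`, the action viewed over
`1 × φ_Θ` itself; `isGeometricQuotient_overMap_iff`).
[cite: MumfordAV1970, §7 Thm. p. 66 and Thm. 4 (p. 72)] -/
theorem isGeometricQuotient_kThetaActionOver :
    (A.kThetaActionOver hΘ).IsGeometricQuotient (Hom.toSchemeHom (A.oneProdPhiTheta hΘ)) :=
  (ActionOver.isGeometricQuotient_overMap_iff _ _ _ _).mpr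
    (A.isGeometricQuotient_kThetaAut_oneProdPhiTheta hΘ).1

/-- **The `K(Θ)`-action on `A × A` is free on the affine charts `(1 × φ_Θ)⁻¹V`** (the
Chase–Harrison–Rosenberg hypothesis `hfree` of the descent theorems): for `V ⊆ A × Â` affine and
`g ≠ 1` the elements `g · b - b`, `b ∈ Γ(A × A, (1 × φ_Θ)⁻¹V)`, generate the unit ideal — a
non-trivial translation has no fixed point (the tree's `span_range_translation_appLE_sub_eq_top`).
[cite: MumfordAV1970, §7 Thm. 4 (p. 72)] -/
theorem kThetaActionOver_free (V : (A.prod (A.dualOf Θ hΘ)).X.left.Opens) (hV : IsAffineOpen V)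
    (g : A.KTheta Θ) (hg : g ≠ 1) :
    Ideal.span (Set.range
      fun b : Γ((A.prod A).X.left, Hom.toSchemeHom (A.oneProdPhiTheta hΘ) ⁻¹ᵁ V) ↦
        (A.kThetaActionOver hΘ).act g V b - b) = ⊤ := by
  haveI := A.isAffineHom_oneProdPhiTheta hΘ
  have hg' : ((g : A.Points ℂ))⁻¹ ≠ 1 := by
    rw [Ne, inv_eq_one]
    exact fun h => hg (Subtype.ext h)
  exact (A.prod A).span_range_translation_appLE_sub_eq_top (hV.preimage _)
    (inrPoint A A ((g : A.Points ℂ)⁻¹)) (A.inrPoint_ne_one hg') _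

/-! ### §2b `φ_Θ : A → Â` is a free affine geometric quotient of `A` by `K(Θ)` -/

/-- **The fibres of `φ_Θ(ℂ)` are the `K(Θ)`-orbits** (`Ker φ_Θ(ℂ) = K(Θ)`).
[cite: MilneAV2008, I §8 (p. 40)] -/
theorem exists_kThetaBaseAut_of_map_eq (P P' : ComplexPoints A.X)
    (h : AlgPoints.map (A.phiTheta Θ hΘ).hom.hom.hom P =
      AlgPoints.map (A.phiTheta Θ hΘ).hom.hom.hom P') :
    ∃ g : A.KTheta Θ, AlgPoints.map (A.kThetaBaseAut Θ g).hom P = P' := by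
  change P ≫ _ = P' ≫ _ at h
  have hmem : P' * P⁻¹ ∈ A.KTheta Θ := by
    rw [← A.ker_monoidHom_phiTheta hΘ, MonoidHom.mem_ker, map_mul, map_inv]
    change (P' ≫ _) * (P ≫ _)⁻¹ = 1
    rw [h, mul_inv_cancel]
  refine ⟨⟨P' * P⁻¹, hmem⟩, ?_⟩
  change P ≫ (A.kThetaBaseAut Θ _).hom = P'
  rw [comp_kThetaBaseAut_hom]
  change P' * P⁻¹ * P = P'
  rw [inv_mul_cancel_right]

/-- **`φ_Θ(ℂ)` is onto** (Milne I Prop. 8.14). [cite: MilneAV2008, I §8 Prop. 8.14 (p. 39)] -/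
theorem surjective_map_phiTheta :
    Function.Surjective (AlgPoints.map (L := ℂ) (A.phiTheta Θ hΘ).hom.hom.hom) := by
  haveI : Surjective (A.phiTheta Θ hΘ).hom.hom.hom.left := (A.isIsogeny_phiTheta hΘ).1
  exact AlgPoints.map_surjective_of_surjective _

/-- **`φ_Θ : A → Â` is the quotient of `A` by `K(Θ)` for separated test objects** (Mumford §7
Thm. 4 for the finite subgroup `K(Θ)`; the tree's recognition theorem).
[cite: MumfordAV1970, §7 Thm. 4 (p. 72)] -/
theorem isSepQuotient_kThetaBaseAut_phiTheta :
    IsSepQuotient (fun g => A.kThetaBaseAut Θ g) (A.phiTheta Θ hΘ).hom.hom.hom := by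
  haveI : Finite ↥(A.KTheta Θ) := A.finite_kTheta_subtype hΘ
  haveI : IsIntegral A.X.left := GeometricallyIntegral.isIntegral_of_subsingleton A.X.hom
  haveI : IsIntegral (A.dualOf Θ hΘ).X.left :=
    GeometricallyIntegral.isIntegral_of_subsingleton (A.dualOf Θ hΘ).X.hom
  haveI : Smooth (A.dualOf Θ hΘ).X.hom := (A.dualOf Θ hΘ).smooth_hom
  haveI : IsProper (A.phiTheta Θ hΘ).hom.hom.hom.left :=
    haveI := (A.isIsogeny_phiTheta hΘ).2; inferInstance
  exact isSepQuotient_of_isProper_of_bijective (A.kThetaBaseAut Θ) (A.phiTheta Θ hΘ).hom.hom.hom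
    (ActionOver.forall_exists_stableAffineOpen_of_isProjectiveOver _
      (AbelianVariety.isProjectiveOver_holds A))
    (A.kThetaBaseAut_hom_comp_phiTheta hΘ) (A.surjective_map_phiTheta hΘ)
    (A.exists_kThetaBaseAut_of_map_eq hΘ)

/-- **`φ_Θ : A → Â = A/K(Θ)` is an affine geometric quotient of `A` by `K(Θ)`** in Mumford's sense,
in the currency of the descent theorems (`ActionOver.IsGeometricQuotient` for
`kThetaBaseActionOver`, the action viewed over `φ_Θ` itself).
[cite: MumfordAV1970, §7 Thm. p. 66 and Thm. 4 (p. 72)] -/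
theorem isGeometricQuotient_kThetaBaseActionOver :
    (A.kThetaBaseActionOver hΘ).IsGeometricQuotient (Hom.toSchemeHom (A.phiTheta Θ hΘ)) := by
  haveI : Finite ↥(A.KTheta Θ) := A.finite_kTheta_subtype hΘ
  exact (ActionOver.isGeometricQuotient_overMap_iff _ _ _ _).mpr
    (isGeometricQuotient_left_of_isSepQuotient (AbelianVariety.isProjectiveOver_holds A)
      inferInstance (A.kThetaBaseAut Θ) (A.phiTheta Θ hΘ).hom.hom.hom
      (A.isSepQuotient_kThetaBaseAut_phiTheta hΘ)).1

/-- **The `K(Θ)`-action on `A` is free on the affine charts `φ_Θ⁻¹V`** (Chase–Harrison–Rosenberg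
hypothesis `hfree` of the descent theorems along `φ_Θ`).
[cite: MumfordAV1970, §7 Thm. 4 (p. 72)] -/
theorem kThetaBaseActionOver_free (V : (A.dualOf Θ hΘ).X.left.Opens) (hV : IsAffineOpen V)
    (g : A.KTheta Θ) (hg : g ≠ 1) :
    Ideal.span (Set.range fun b : Γ(A.X.left, Hom.toSchemeHom (A.phiTheta Θ hΘ) ⁻¹ᵁ V) ↦
      (A.kThetaBaseActionOver hΘ).act g V b - b) = ⊤ := by
  haveI := A.isAffineHom_phiTheta hΘ
  have hg' : ((g : A.Points ℂ))⁻¹ ≠ 1 := by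
    rw [Ne, inv_eq_one]
    exact fun h => hg (Subtype.ext h)
  exact A.span_range_translation_appLE_sub_eq_top (hV.preimage _) ((g : A.Points ℂ)⁻¹) hg' _

/-! ### §3 Consequence: `K(Θ)`-linearised modules on `A × A` descend to `A × Â` -/

section Descent

/-- **Descent of `K(Θ)`-linearised vector bundles along `1 × φ_Θ`** (Milne, *Abelian Varieties* I §8
p. 40 / Prop. 8.13: "the action of `K(L)` on the second factor of `A × A` lifts to an action on
`L^*` over `A × A`, which corresponds to a sheaf `𝒫` on `A × A^∨` such that `(1 × λ_L)^*𝒫 = L^*`";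
Mumford §12 Thm. 1): an `𝒪_{A × A}`-module `E` of rank `r` with a `K(Θ)`-equivariant structure
`φ` for the action `kThetaActionOver` (unit and cocycle conditions of
`RelativeSpec/EquivariantModuleInvariants`) is `(1 × φ_Θ)^* F` for a quasi-coherent `F` OF RANK `r`
on `A × Â`, compatibly with `φ` — the tree's (T1)+(β)
`ActionOver.exists_descent_of_free_of_hasRank` fed with `isGeometricQuotient_kThetaActionOver`,
`kThetaActionOver_free`, `isAffineHom_oneProdPhiTheta`, `kThetaFintype`. For `E = Λ(𝒪(Θ))`,
`r = 1`, the descended `F` is the Poincaré sheaf.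
[cite: MilneAV2008, I §8 (p. 40) and Prop. 8.13] -/
theorem exists_descent_along_oneProdPhiTheta (E : (A.prod A).X.left.Modules)
    (φ : ∀ g : A.KTheta Θ,
      (Scheme.Modules.pullback ((A.kThetaActionOver hΘ).aut g).hom).obj E ≅ E)
    (hunit : (φ 1).hom =
      ((Scheme.Modules.pullbackCongr (A.kThetaActionOver hΘ).aut_one_hom).app E).hom ≫
        ((Scheme.Modules.pullbackId (A.prod A).X.left).app E).hom)
    (hcocycle : ∀ g h : A.KTheta Θ, (φ (g * h)).hom =
      ((Scheme.Modules.pullbackCongr ((A.kThetaActionOver hΘ).aut_mul_hom g h)).app E).hom ≫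
        ((Scheme.Modules.pullbackComp ((A.kThetaActionOver hΘ).aut h).hom
          ((A.kThetaActionOver hΘ).aut g).hom).app E).inv ≫
          (Scheme.Modules.pullback ((A.kThetaActionOver hΘ).aut h).hom).map (φ g).hom ≫ (φ h).hom)
    {r : ℕ} (hE : HasRank E r) :
    ∃ (F : (A.prod (A.dualOf Θ hΘ)).X.left.Modules) (_ : F.IsQuasicoherent) (_ : HasRank F r)
      (e : (Scheme.Modules.pullback (Hom.toSchemeHom (A.oneProdPhiTheta hΘ))).obj F ≅ E),
      ∀ g : A.KTheta Θ,
        (Scheme.Modules.pullback ((A.kThetaActionOver hΘ).aut g).hom).map e.hom ≫ (φ g).hom =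
          ((Scheme.Modules.pullbackComp ((A.kThetaActionOver hΘ).aut g).hom
              (Hom.toSchemeHom (A.oneProdPhiTheta hΘ))).app F ≪≫
            (Scheme.Modules.pullbackCongr
              ((A.kThetaActionOver hΘ).aut_comp g)).app F).hom ≫ e.hom := by
  haveI : Finite ↥(A.KTheta Θ) := A.finite_kTheta_subtype hΘ
  haveI : Fintype ↥(A.KTheta Θ) := Fintype.ofFinite _
  haveI := A.isAffineHom_oneProdPhiTheta hΘ
  exact (A.kThetaActionOver hΘ).exists_descent_of_free_of_hasRank E φ
    (A.isGeometricQuotient_kThetaActionOver hΘ) (A.kThetaActionOver_free hΘ) hunit hcocycle hE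

/-- Generic junction (any free affine geometric quotient): (T1)+(β) with the equivariant structure
bundled as `ActionOver.EquivariantStructure`. Private plumbing: stated for a variable action `ρ` so
that instantiating it at `kThetaActionOver` is a syntactic match. [folklore] -/
private theorem exists_descent_of_equivariantStructure_aux {X Q : Scheme.{u}} {p : X ⟶ Q}
    {G : Type u} [Group G] [Fintype G] [IsAffineHom p] (ρ : ActionOver p G)
    (hq : ρ.IsGeometricQuotient p)
    (hfree : ∀ (V : Q.Opens), IsAffineOpen V → ∀ g : G, g ≠ 1 →
      Ideal.span (Set.range fun b : Γ(X, p ⁻¹ᵁ V) ↦ ρ.act g V b - b) = ⊤)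
    (E : X.Modules) (Φ : ρ.EquivariantStructure E) {r : ℕ} (hE : HasRank E r) :
    ∃ (F : Q.Modules) (_ : F.IsQuasicoherent) (_ : HasRank F r)
      (e : (Scheme.Modules.pullback p).obj F ≅ E),
      ∀ g : G, (Scheme.Modules.pullback (ρ.aut g).hom).map e.hom ≫ (Φ.iso g).hom =
        ((Scheme.Modules.pullbackComp (ρ.aut g).hom p).app F ≪≫
          (Scheme.Modules.pullbackCongr (ρ.aut_comp g)).app F).hom ≫ e.hom :=
  ρ.exists_descent_of_free_of_hasRank E Φ.iso hq hfree Φ.iso_one_hom Φ.iso_mul_hom hE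

/-- **Descent of `K(Θ)`-linearised vector bundles along `1 × φ_Θ`, bundled form**: the same with
the equivariant structure given as the tree's `ActionOver.EquivariantStructure`
(`Modules/EquivariantStructure`: `iso`, `iso_one_hom`, `iso_mul_hom`). For (J0a): a
`K(Θ)`-linearisation `Φ` of Mumford's `Λ(𝒪(Θ))` yields the Poincaré sheaf on `A × Â` as a
rank-one quasi-coherent module with `(1 × φ_Θ)^* 𝒫 ≅ Λ(𝒪(Θ))`.
[cite: MilneAV2008, I §8 (p. 40) and Prop. 8.13] -/
theorem exists_descent_of_equivariantStructure (E : (A.prod A).X.left.Modules)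
    (Φ : (A.kThetaActionOver hΘ).EquivariantStructure E) {r : ℕ} (hE : HasRank E r) :
    ∃ (F : (A.prod (A.dualOf Θ hΘ)).X.left.Modules) (_ : F.IsQuasicoherent) (_ : HasRank F r)
      (e : (Scheme.Modules.pullback (Hom.toSchemeHom (A.oneProdPhiTheta hΘ))).obj F ≅ E),
      ∀ g : A.KTheta Θ,
        (Scheme.Modules.pullback ((A.kThetaActionOver hΘ).aut g).hom).map e.hom ≫ (Φ.iso g).hom =
          ((Scheme.Modules.pullbackComp ((A.kThetaActionOver hΘ).aut g).hom
              (Hom.toSchemeHom (A.oneProdPhiTheta hΘ))).app F ≪≫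
            (Scheme.Modules.pullbackCongr
              ((A.kThetaActionOver hΘ).aut_comp g)).app F).hom ≫ e.hom :=
  haveI : Finite ↥(A.KTheta Θ) := A.finite_kTheta_subtype hΘ
  haveI : Fintype ↥(A.KTheta Θ) := Fintype.ofFinite _
  haveI := A.isAffineHom_oneProdPhiTheta hΘ
  exists_descent_of_equivariantStructure_aux (A.kThetaActionOver hΘ)
    (A.isGeometricQuotient_kThetaActionOver hΘ) (A.kThetaActionOver_free hΘ) E Φ hE

end Descent

end AbelianVariety

end Literature.AlgebraicGeometry.Motives

end
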